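import Literature.NumberTheory.Automorphic.UnitaryGroupHeisenbergBorelConj
import HarnessLib

/-!
# Conjugating the Heisenberg fundamental domain by a RATIONAL Borel element: `β⁻¹ 𝓕_N β` is again a fundamental domain for `N(F)`
# (the dilated domains `𝓕_m = t_m⁻¹ 𝓕_N t_m`, `t_m = diag(m⁻¹, 1, m) ∈ T(F)`, of the cusp estimate)
(Rogawski, *Automorphic Representations of Unitary Groups in Three Variables* (1990), §1.10, §2.1; Getz–Hahn (2024), §3.5)

Topic `NumberTheory/Automorphic`; namespace `Literature.NumberTheory.Automorphic.UnitaryGroup`.  THEOREMS ONLY (kernel lane): no `def`,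
no named fact, no instance, no notation, no `sorry`.  Row H5b (FILE 1b) of the T1-qs sub-line of the floor-0 engine line `F0_T1InnerFormTraceIdentity`
(cell hodgecm-mathlib, F0P3a RULING #100 (a); H5 trunk A-p09 (g20)): the oscillation estimate of the truncated kernel is read on a fundamental
domain of `N(F)\N(𝔸_F)` whose FINITE part is small — obtained from the tree's `𝓕_N = heisFundamentalDomain` (★ `UnitaryGroupHeisenbergFundamentalDomain`)
by conjugating with a rational torus element (the truncated kernel does not depend on the choice of the fundamental domain, ★
`truncatedKernel_eq_of_isFundamentalDomain`).

For `β ∈ B(𝔸_F)` RATIONAL (`β ∈ (quasiSplit F E c 3).arithmeticSubgroup`) write `φ_β(v) = β⁻¹ v β` (★ `borel_inv_mul_mul_mem_adelicUnipotent`):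
* §1 `conj_rational_mem_rationalUnipotent` — `β⁻¹ γ β ∈ N(F)` for `γ ∈ N(F)`; **`existsUnique_smul_mem_borelConj_image`** — every `u ∈ N(𝔸_F)` has exactly
  one `N(F)`-translate in `φ_β '' 𝓕_N` (transport of ★ `existsUnique_smul_mem_heisFundamentalDomain`); `mem_borelConj_image_iff` (`w ∈ φ_β '' 𝓕_N ↔ β w β⁻¹ ∈ 𝓕_N`);
  `exists_isCompact_borelConj_heisFundamentalDomain_subset`; **`isFundamentalDomain_borelConj_image`** — `φ_β '' 𝓕_N` is a measurable fundamental domain for the left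
  action of `N(F)` on `N(𝔸_F)`, for every measure (§4, `measurableSet_borelConj_image`).
* §2 `coe_coordY_torus_conj` — for `t = diag(d) ∈ T(𝔸_F)`: `y(t⁻¹ u t) = d₀⁻¹d₂ · y(u)` (and `x(t⁻¹ u t) = d₀⁻¹d₁ · x(u)`, ★ `coordX_borel_conj`);
  **`mem_torusConj_image_iff`** — `u ∈ t⁻¹ 𝓕_N t ↔ (x(u), y(u)) = (d₀⁻¹d₁ · x, d₀⁻¹d₂ · y)` with `(x, y) ∈ D_E × 𝓕⁻` (Tate's domain × the trace-zero domain).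
* §3 **`exists_rational_torus_diag`** — for `m ∈ F×` the rational diagonal element `t_m = diag(m⁻¹, 1, m) ∈ T(F) ≤ B(𝔸_F)` (so `d₀⁻¹d₁ = m`, `d₀⁻¹d₂ = m²`:
  the dilated domain `𝓕_m := t_m⁻¹ 𝓕_N t_m` has coordinates `(m·x, m²·y)`; for `m ∈ 𝓞_F` divisible enough its finite part is as small as a given level requires,
  at the price of an archimedean factor `m²` — the choice made in the oscillation estimate of the truncated kernel, Rogawski (1990), §2.2).

## References
* J. D. Rogawski, *Automorphic Representations of Unitary Groups in Three Variables*, Ann. of Math. Stud. 123 (1990), §1.10, §2.1 [Rogawski1990].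
* J. R. Getz, H. Hahn, *An Introduction to Automorphic Representations*, GTM 300 (2024), §3.5 [GetzHahn2024].
-/

set_option autoImplicit false

noncomputable section

open Matrix NumberField IsDedekindDomain Topology MeasureTheory
open scoped MatrixGroups

namespace Literature.NumberTheory.Automorphic

namespace UnitaryGroup

variable {F E : Type} [Field F] [NumberField F] [Field E] [NumberField E] [Algebra F E]
  {c : E ≃ₐ[F] E}

/-! ## §1 `β⁻¹ 𝓕_N β` is a fundamental domain for a rational `β ∈ B(𝔸_F)` -/

/-- `β⁻¹ γ β ∈ N(F)` for `β ∈ B(𝔸_F)` rational and `γ ∈ N(F)` (both lie in the arithmetic subgroup, and `B` normalises `N`). [cite: Rogawski1990, §1.10] -/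
theorem conj_rational_mem_rationalUnipotent (β : borelAdelic F E c 3) (hβ : (β : (quasiSplit F E c 3).Adelic) ∈ (quasiSplit F E c 3).arithmeticSubgroup)
    (γ : rationalUnipotent F E c 3) :
    (⟨(β : (quasiSplit F E c 3).Adelic)⁻¹ * ((γ : adelicUnipotent F E c 3) : (quasiSplit F E c 3).Adelic) * (β : (quasiSplit F E c 3).Adelic),
        borel_inv_mul_mul_mem_adelicUnipotent β γ⟩ : adelicUnipotent F E c 3) ∈ rationalUnipotent F E c 3 := by
  change (β : (quasiSplit F E c 3).Adelic)⁻¹ * ((γ : adelicUnipotent F E c 3) : (quasiSplit F E c 3).Adelic) * (β : (quasiSplit F E c 3).Adelic) ∈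
    (quasiSplit F E c 3).arithmeticSubgroup
  exact Subgroup.mul_mem _ (Subgroup.mul_mem _ (Subgroup.inv_mem _ hβ) γ.2) hβ

/-- **Membership in `β⁻¹ 𝓕_N β`**: `w ∈ φ_β '' 𝓕_N ↔ β w β⁻¹ ∈ 𝓕_N`. [cite: Rogawski1990, §2.1] -/
theorem mem_borelConj_image_iff (hc : c * c = 1) (β : borelAdelic F E c 3) (w : adelicUnipotent F E c 3) :
    w ∈ (fun v : adelicUnipotent F E c 3 => (⟨(β : (quasiSplit F E c 3).Adelic)⁻¹ * (v : (quasiSplit F E c 3).Adelic) * (β : (quasiSplit F E c 3).Adelic),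
        borel_inv_mul_mul_mem_adelicUnipotent β v⟩ : adelicUnipotent F E c 3)) '' heisFundamentalDomain F E c hc ↔
      (⟨((β⁻¹ : borelAdelic F E c 3) : (quasiSplit F E c 3).Adelic)⁻¹ * (w : (quasiSplit F E c 3).Adelic) * ((β⁻¹ : borelAdelic F E c 3) : (quasiSplit F E c 3).Adelic),
        borel_inv_mul_mul_mem_adelicUnipotent β⁻¹ w⟩ : adelicUnipotent F E c 3) ∈ heisFundamentalDomain F E c hc := by
  constructor
  · rintro ⟨v, hv, rfl⟩
    convert hv using 1
    refine Subtype.ext ?_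
    change ((β⁻¹ : borelAdelic F E c 3) : (quasiSplit F E c 3).Adelic)⁻¹ *
      ((β : (quasiSplit F E c 3).Adelic)⁻¹ * (v : (quasiSplit F E c 3).Adelic) * (β : (quasiSplit F E c 3).Adelic)) *
        ((β⁻¹ : borelAdelic F E c 3) : (quasiSplit F E c 3).Adelic) = (v : (quasiSplit F E c 3).Adelic)
    simp only [Subgroup.coe_inv]
    group
  · intro hw
    refine ⟨_, hw, Subtype.ext ?_⟩
    change (β : (quasiSplit F E c 3).Adelic)⁻¹ *
      (((β⁻¹ : borelAdelic F E c 3) : (quasiSplit F E c 3).Adelic)⁻¹ * (w : (quasiSplit F E c 3).Adelic) * ((β⁻¹ : borelAdelic F E c 3) : (quasiSplit F E c 3).Adelic)) *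
        (β : (quasiSplit F E c 3).Adelic) = (w : (quasiSplit F E c 3).Adelic)
    simp only [Subgroup.coe_inv]
    group

/-- **Unique representability in `β⁻¹ 𝓕_N β`**: for `β ∈ B(𝔸_F)` rational, every `u ∈ N(𝔸_F)` has exactly one left `N(F)`-translate in `φ_β '' 𝓕_N`
(transport of ★ `existsUnique_smul_mem_heisFundamentalDomain` along `φ_β`, which maps `N(F)` onto itself). [cite: Rogawski1990, §2.1] -/
theorem existsUnique_smul_mem_borelConj_image (hc : c * c = 1) (β : borelAdelic F E c 3)
    (hβ : (β : (quasiSplit F E c 3).Adelic) ∈ (quasiSplit F E c 3).arithmeticSubgroup) (u : adelicUnipotent F E c 3) :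
    ∃! γ : rationalUnipotent F E c 3, γ • u ∈
      (fun v : adelicUnipotent F E c 3 => (⟨(β : (quasiSplit F E c 3).Adelic)⁻¹ * (v : (quasiSplit F E c 3).Adelic) * (β : (quasiSplit F E c 3).Adelic),
        borel_inv_mul_mul_mem_adelicUnipotent β v⟩ : adelicUnipotent F E c 3)) '' heisFundamentalDomain F E c hc := by
  -- `ψ u = β u β⁻¹`
  set ψu : adelicUnipotent F E c 3 := ⟨((β⁻¹ : borelAdelic F E c 3) : (quasiSplit F E c 3).Adelic)⁻¹ * (u : (quasiSplit F E c 3).Adelic) *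
      ((β⁻¹ : borelAdelic F E c 3) : (quasiSplit F E c 3).Adelic), borel_inv_mul_mul_mem_adelicUnipotent β⁻¹ u⟩ with hψu
  obtain ⟨γ₁, hγ₁, huniq⟩ := existsUnique_smul_mem_heisFundamentalDomain hc ψu
  have hβ' : ((β⁻¹ : borelAdelic F E c 3) : (quasiSplit F E c 3).Adelic) ∈ (quasiSplit F E c 3).arithmeticSubgroup := by
    rw [Subgroup.coe_inv]; exact Subgroup.inv_mem _ hβ
  refine ⟨⟨_, conj_rational_mem_rationalUnipotent β hβ γ₁⟩, ?_, ?_⟩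
  · -- existence: `(β⁻¹ γ₁ β) • u ∈ φ_β '' 𝓕_N` since `β ((β⁻¹γ₁β) u) β⁻¹ = γ₁ (β u β⁻¹) ∈ 𝓕_N`
    beta_reduce
    rw [mem_borelConj_image_iff hc β]
    convert hγ₁ using 1
    refine Subtype.ext ?_
    rw [Subgroup.smul_def, smul_eq_mul, Subgroup.smul_def, smul_eq_mul]
    change ((β⁻¹ : borelAdelic F E c 3) : (quasiSplit F E c 3).Adelic)⁻¹ *
      (((β : (quasiSplit F E c 3).Adelic)⁻¹ * ((γ₁ : adelicUnipotent F E c 3) : (quasiSplit F E c 3).Adelic) * (β : (quasiSplit F E c 3).Adelic)) *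
        (u : (quasiSplit F E c 3).Adelic)) * ((β⁻¹ : borelAdelic F E c 3) : (quasiSplit F E c 3).Adelic) =
      ((γ₁ : adelicUnipotent F E c 3) : (quasiSplit F E c 3).Adelic) *
        (((β⁻¹ : borelAdelic F E c 3) : (quasiSplit F E c 3).Adelic)⁻¹ * (u : (quasiSplit F E c 3).Adelic) * ((β⁻¹ : borelAdelic F E c 3) : (quasiSplit F E c 3).Adelic))
    simp only [Subgroup.coe_inv]
    group
  · -- uniqueness: `γ • u ∈ φ_β '' 𝓕_N` ⇒ `(β γ β⁻¹) • ψ u ∈ 𝓕_N` ⇒ `β γ β⁻¹ = γ₁`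
    intro γ hγ
    rw [mem_borelConj_image_iff hc β] at hγ
    have hmem : (⟨_, conj_rational_mem_rationalUnipotent β⁻¹ hβ' γ⟩ : rationalUnipotent F E c 3) • ψu ∈ heisFundamentalDomain F E c hc := by
      convert hγ using 1
      refine Subtype.ext ?_
      rw [Subgroup.smul_def, smul_eq_mul, Subgroup.smul_def, smul_eq_mul]
      change (((β⁻¹ : borelAdelic F E c 3) : (quasiSplit F E c 3).Adelic)⁻¹ * ((γ : adelicUnipotent F E c 3) : (quasiSplit F E c 3).Adelic) *
          ((β⁻¹ : borelAdelic F E c 3) : (quasiSplit F E c 3).Adelic)) *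
        (((β⁻¹ : borelAdelic F E c 3) : (quasiSplit F E c 3).Adelic)⁻¹ * (u : (quasiSplit F E c 3).Adelic) * ((β⁻¹ : borelAdelic F E c 3) : (quasiSplit F E c 3).Adelic)) =
        ((β⁻¹ : borelAdelic F E c 3) : (quasiSplit F E c 3).Adelic)⁻¹ *
          (((γ : adelicUnipotent F E c 3) : (quasiSplit F E c 3).Adelic) * (u : (quasiSplit F E c 3).Adelic)) *
            ((β⁻¹ : borelAdelic F E c 3) : (quasiSplit F E c 3).Adelic)
      simp only [Subgroup.coe_inv]
      group
    have hγ₁eq := huniq _ hmem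
    -- `γ = β⁻¹ (β γ β⁻¹) β`
    refine Subtype.ext (Subtype.ext ?_)
    change ((γ : adelicUnipotent F E c 3) : (quasiSplit F E c 3).Adelic) =
      (β : (quasiSplit F E c 3).Adelic)⁻¹ * ((γ₁ : adelicUnipotent F E c 3) : (quasiSplit F E c 3).Adelic) * (β : (quasiSplit F E c 3).Adelic)
    rw [← hγ₁eq]
    change ((γ : adelicUnipotent F E c 3) : (quasiSplit F E c 3).Adelic) =
      (β : (quasiSplit F E c 3).Adelic)⁻¹ *
        (((β⁻¹ : borelAdelic F E c 3) : (quasiSplit F E c 3).Adelic)⁻¹ * ((γ : adelicUnipotent F E c 3) : (quasiSplit F E c 3).Adelic) *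
          ((β⁻¹ : borelAdelic F E c 3) : (quasiSplit F E c 3).Adelic)) * (β : (quasiSplit F E c 3).Adelic)
    simp only [Subgroup.coe_inv]
    group

/-- `β⁻¹ 𝓕_N β` is contained in a compact set (continuous image of ★ `exists_isCompact_heisFundamentalDomain_subset`). [cite: Rogawski1990, §2.1] -/
theorem exists_isCompact_borelConj_heisFundamentalDomain_subset (hc : c * c = 1) (β : borelAdelic F E c 3) :
    ∃ K : Set (adelicUnipotent F E c 3), IsCompact K ∧
      (fun v : adelicUnipotent F E c 3 => (⟨(β : (quasiSplit F E c 3).Adelic)⁻¹ * (v : (quasiSplit F E c 3).Adelic) * (β : (quasiSplit F E c 3).Adelic),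
        borel_inv_mul_mul_mem_adelicUnipotent β v⟩ : adelicUnipotent F E c 3)) '' heisFundamentalDomain F E c hc ⊆ K := by
  obtain ⟨K, hK, hsub⟩ := exists_isCompact_heisFundamentalDomain_subset (F := F) (E := E) (c := c) hc
  have hcont : Continuous (fun v : adelicUnipotent F E c 3 =>
      (⟨(β : (quasiSplit F E c 3).Adelic)⁻¹ * (v : (quasiSplit F E c 3).Adelic) * (β : (quasiSplit F E c 3).Adelic),
        borel_inv_mul_mul_mem_adelicUnipotent β v⟩ : adelicUnipotent F E c 3)) :=
    Continuous.subtype_mk ((continuous_const.mul continuous_subtype_val).mul continuous_const) _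
  exact ⟨_, hK.image hcont, Set.image_mono hsub⟩


/-! ## §2 Conjugation by a torus element: the coordinates scale -/

/-- **`y(t⁻¹ u t) = d₀⁻¹ d₂ · y(u)`** for `t ∈ T(𝔸_F)` (the unipotent part of `t` is `1`, so the correction term of ★ `coe_coordY_borel_conj` vanishes;
`x(t⁻¹ u t) = d₀⁻¹ d₁ · x(u)` is ★ `coordX_borel_conj` verbatim). [cite: Rogawski1990, §1.10] -/
theorem coe_coordY_torus_conj (hc : c * c = 1) (t : borelAdelic F E c 3)
    (ht : (t : (quasiSplit F E c 3).Adelic) ∈ torusAdelic F E c 3) (u : adelicUnipotent F E c 3) :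
    (coordY hc ⟨(t : (quasiSplit F E c 3).Adelic)⁻¹ * (u : (quasiSplit F E c 3).Adelic) * (t : (quasiSplit F E c 3).Adelic),
        borel_inv_mul_mul_mem_adelicUnipotent t u⟩ : AdeleRing (𝓞 E) E) =
      ((((diagUnit t.2 0)⁻¹ * diagUnit t.2 2 : (AdeleRing (𝓞 E) E)ˣ)) : AdeleRing (𝓞 E) E) * (coordY hc u : AdeleRing (𝓞 E) E) := by
  rw [coe_coordY_borel_conj hc t u]
  have h1 : (⟨(((torusPart t)⁻¹ * t : borelAdelic F E c 3) : (quasiSplit F E c 3).Adelic), torusPart_inv_mul_mem_adelicUnipotent t⟩ :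
      adelicUnipotent F E c 3) = 1 := by
    refine Subtype.ext ?_
    change (((torusPart t)⁻¹ * t : borelAdelic F E c 3) : (quasiSplit F E c 3).Adelic) = ((1 : borelAdelic F E c 3) : (quasiSplit F E c 3).Adelic)
    rw [torusPart_eq_self_of_mem ht, inv_mul_cancel]
  rw [h1, coordX_one, map_zero, zero_mul, mul_zero, sub_self, add_zero]

/-- **`t⁻¹ 𝓕_N t` in coordinates** for `t = diag(d) ∈ T(𝔸_F)`: `u ∈ t⁻¹ 𝓕_N t ↔ x(u) = d₀⁻¹d₁ · x`, `y(u) = d₀⁻¹d₂ · y` with `(x, y) ∈ D_E × 𝓕⁻`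
(`𝓕_N = heisChart(D_E × 𝓕⁻)`, ★ `mem_heisFundamentalDomain_iff`). [cite: Rogawski1990, §2.1] -/
theorem mem_torusConj_image_iff (hc : c * c = 1) (t : borelAdelic F E c 3)
    (ht : (t : (quasiSplit F E c 3).Adelic) ∈ torusAdelic F E c 3) (u : adelicUnipotent F E c 3) :
    u ∈ (fun v : adelicUnipotent F E c 3 => (⟨(t : (quasiSplit F E c 3).Adelic)⁻¹ * (v : (quasiSplit F E c 3).Adelic) * (t : (quasiSplit F E c 3).Adelic),
        borel_inv_mul_mul_mem_adelicUnipotent t v⟩ : adelicUnipotent F E c 3)) '' heisFundamentalDomain F E c hc ↔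
      ∃ x ∈ adeleFundamentalDomain E, ∃ y ∈ traceZeroFundamentalDomain F E c,
        coordX u = ((((diagUnit t.2 0)⁻¹ * diagUnit t.2 1 : (AdeleRing (𝓞 E) E)ˣ)) : AdeleRing (𝓞 E) E) * x ∧
          (coordY hc u : AdeleRing (𝓞 E) E) = ((((diagUnit t.2 0)⁻¹ * diagUnit t.2 2 : (AdeleRing (𝓞 E) E)ˣ)) : AdeleRing (𝓞 E) E) * (y : AdeleRing (𝓞 E) E) := by
  constructor
  · rintro ⟨v, hv, rfl⟩
    rw [mem_heisFundamentalDomain_iff] at hv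
    exact ⟨coordX v, hv.1, coordY hc v, hv.2, coordX_borel_conj t v, coe_coordY_torus_conj hc t ht v⟩
  · rintro ⟨x, hx, y, hy, hX, hY⟩
    refine ⟨heisChart hc (x, y), (mem_heisFundamentalDomain_iff hc _).2 ⟨by rwa [coordX_heisChart], by rwa [coordY_heisChart]⟩, ?_⟩
    have e1 : coordX (⟨(t : (quasiSplit F E c 3).Adelic)⁻¹ * ((heisChart hc (x, y) : adelicUnipotent F E c 3) : (quasiSplit F E c 3).Adelic) *
        (t : (quasiSplit F E c 3).Adelic), borel_inv_mul_mul_mem_adelicUnipotent t _⟩ : adelicUnipotent F E c 3) = coordX u := by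
      rw [coordX_borel_conj, coordX_heisChart, hX]
    have e2 : coordY hc (⟨(t : (quasiSplit F E c 3).Adelic)⁻¹ * ((heisChart hc (x, y) : adelicUnipotent F E c 3) : (quasiSplit F E c 3).Adelic) *
        (t : (quasiSplit F E c 3).Adelic), borel_inv_mul_mul_mem_adelicUnipotent t _⟩ : adelicUnipotent F E c 3) = coordY hc u :=
      Subtype.ext (by rw [coe_coordY_torus_conj hc t ht, coordY_heisChart, hY])
    rw [← heisChart_coord hc u, ← e1, ← e2, heisChart_coord]

/-! ## §3 The rational torus elements `t_m = diag(m⁻¹, 1, m)`, `m ∈ F×`, and the dilated domains `𝓕_m = t_m⁻¹ 𝓕_N t_m` -/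

/-- **The rational torus element `t_m = diag(m⁻¹, 1, m) ∈ T(F)`** for `m ∈ F×`: `diag(m⁻¹, 1, m) ∈ U(J₃)(E)` (the torus relations `c(d_{2−i}) dᵢ = 1` hold since
`c` fixes `F`), pushed to `B(𝔸_F)`; it is rational, diagonal, with diagonal idèles `(m⁻¹, 1, m)` — so `d₀⁻¹d₁ = m`, `d₀⁻¹d₂ = m²` and `t_m⁻¹ 𝓕_N t_m` has
coordinates `(m·x, m²·y)`, `(x, y) ∈ D_E × 𝓕⁻` (`mem_torusConj_image_iff`). [cite: Rogawski1990, §1.10] -/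
theorem exists_rational_torus_diag (m : F) (hm : m ≠ 0) :
    ∃ t : borelAdelic F E c 3, (t : (quasiSplit F E c 3).Adelic) ∈ (quasiSplit F E c 3).arithmeticSubgroup ∧
      (t : (quasiSplit F E c 3).Adelic) ∈ torusAdelic F E c 3 ∧
      ((diagUnit t.2 0 : (AdeleRing (𝓞 E) E)ˣ) : AdeleRing (𝓞 E) E) = algebraMap E (AdeleRing (𝓞 E) E) (algebraMap F E m)⁻¹ ∧
      ((diagUnit t.2 1 : (AdeleRing (𝓞 E) E)ˣ) : AdeleRing (𝓞 E) E) = 1 ∧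
      ((diagUnit t.2 2 : (AdeleRing (𝓞 E) E)ˣ) : AdeleRing (𝓞 E) E) = algebraMap E (AdeleRing (𝓞 E) E) (algebraMap F E m) := by
  have hM : algebraMap F E m ≠ 0 := (map_ne_zero (algebraMap F E)).2 hm
  set M : Eˣ := Units.mk0 _ hM with hMdef
  set d : Fin 3 → Eˣ := ![M⁻¹, 1, M] with hd
  have hcM : c (algebraMap F E m) = algebraMap F E m := c.commutes m
  have hd0 : d 0 = M⁻¹ := rfl
  have hd1 : d 1 = 1 := rfl
  have hd2 : d 2 = M := rfl
  have hmem : glDiagonal 3 E d ∈ unitaryGroupOfForm (c : E →+* E) ((StdForm.antidiagonal 3).over E) := by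
    rw [glDiagonal_mem_unitaryGroupOfForm_antidiagonal_iff]
    have r0 : (0 : Fin 3).rev = 2 := rfl
    have r1 : (1 : Fin 3).rev = 1 := rfl
    have r2 : (2 : Fin 3).rev = 0 := rfl
    intro i
    fin_cases i
    · change c ((d (Fin.rev 0) : E)) * (d 0 : E) = 1
      rw [r0, hd2, hd0, hMdef, Units.val_mk0, Units.val_inv_eq_inv_val, Units.val_mk0, hcM, mul_inv_cancel₀ hM]
    · change c ((d (Fin.rev 1) : E)) * (d 1 : E) = 1
      rw [r1, hd1, Units.val_one, map_one, mul_one]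
    · change c ((d (Fin.rev 2) : E)) * (d 2 : E) = 1
      rw [r2, hd0, hd2, hMdef, Units.val_inv_eq_inv_val, Units.val_mk0, map_inv₀, hcM, inv_mul_cancel₀ hM]
  set γ : rational F E c 3 ((StdForm.antidiagonal 3).over E) := ⟨glDiagonal 3 E d, hmem⟩ with hγ
  set t₀ : (quasiSplit F E c 3).Adelic := (quasiSplit F E c 3).toAdelic γ with ht₀
  have hval : adelicVal F E c 3 _ t₀ =
      glDiagonal 3 (AdeleRing (𝓞 E) E) (fun i => Units.map (algebraMap E (AdeleRing (𝓞 E) E)).toMonoidHom (d i)) := by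
    refine Matrix.GeneralLinearGroup.ext fun i j => ?_
    change algebraMap E (AdeleRing (𝓞 E) E) ((glDiagonal 3 E d : Matrix (Fin 3) (Fin 3) E) i j) = _
    rw [coe_glDiagonal, coe_glDiagonal, Matrix.diagonal_apply, Matrix.diagonal_apply]
    split_ifs
    · rfl
    · exact map_zero _
  have htorus : t₀ ∈ torusAdelic F E c 3 := ⟨_, hval.symm⟩
  refine ⟨⟨t₀, torusAdelic_le_borelAdelic htorus⟩, ⟨γ, rfl⟩, htorus, ?_, ?_, ?_⟩
  · rw [coe_diagUnit, hval, coe_glDiagonal, Matrix.diagonal_apply_eq, hd0, hMdef]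
    change algebraMap E (AdeleRing (𝓞 E) E) (((Units.mk0 _ hM)⁻¹ : Eˣ) : E) = _
    rw [Units.val_inv_eq_inv_val, Units.val_mk0]
  · rw [coe_diagUnit, hval, coe_glDiagonal, Matrix.diagonal_apply_eq, hd1, map_one, Units.val_one]
  · rw [coe_diagUnit, hval, coe_glDiagonal, Matrix.diagonal_apply_eq, hd2, hMdef]
    rfl

section Measure

variable [MeasurableSpace (AdeleRing (𝓞 E) E)] [BorelSpace (AdeleRing (𝓞 E) E)]
  [MeasurableSpace (adelicUnipotent F E c 3)] [BorelSpace (adelicUnipotent F E c 3)]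

/-- `β⁻¹ 𝓕_N β` is a Borel set (image of the Borel set ★ `measurableSet_heisFundamentalDomain` under the homeomorphism `φ_β`). [cite: Rogawski1990, §2.1] -/
theorem measurableSet_borelConj_image (hc : c * c = 1) (β : borelAdelic F E c 3) :
    MeasurableSet ((fun v : adelicUnipotent F E c 3 => (⟨(β : (quasiSplit F E c 3).Adelic)⁻¹ * (v : (quasiSplit F E c 3).Adelic) * (β : (quasiSplit F E c 3).Adelic),
        borel_inv_mul_mul_mem_adelicUnipotent β v⟩ : adelicUnipotent F E c 3)) '' heisFundamentalDomain F E c hc) := by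
  let e : adelicUnipotent F E c 3 ≃ₜ adelicUnipotent F E c 3 :=
    { toFun := fun v => ⟨(β : (quasiSplit F E c 3).Adelic)⁻¹ * (v : (quasiSplit F E c 3).Adelic) * (β : (quasiSplit F E c 3).Adelic),
        borel_inv_mul_mul_mem_adelicUnipotent β v⟩
      invFun := fun w => ⟨((β⁻¹ : borelAdelic F E c 3) : (quasiSplit F E c 3).Adelic)⁻¹ * (w : (quasiSplit F E c 3).Adelic) *
        ((β⁻¹ : borelAdelic F E c 3) : (quasiSplit F E c 3).Adelic), borel_inv_mul_mul_mem_adelicUnipotent β⁻¹ w⟩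
      left_inv := fun v => Subtype.ext (by
        change ((β⁻¹ : borelAdelic F E c 3) : (quasiSplit F E c 3).Adelic)⁻¹ *
          ((β : (quasiSplit F E c 3).Adelic)⁻¹ * (v : (quasiSplit F E c 3).Adelic) * (β : (quasiSplit F E c 3).Adelic)) *
            ((β⁻¹ : borelAdelic F E c 3) : (quasiSplit F E c 3).Adelic) = (v : (quasiSplit F E c 3).Adelic)
        simp only [Subgroup.coe_inv]
        group)
      right_inv := fun w => Subtype.ext (by
        change (β : (quasiSplit F E c 3).Adelic)⁻¹ *
          (((β⁻¹ : borelAdelic F E c 3) : (quasiSplit F E c 3).Adelic)⁻¹ * (w : (quasiSplit F E c 3).Adelic) * ((β⁻¹ : borelAdelic F E c 3) : (quasiSplit F E c 3).Adelic)) *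
            (β : (quasiSplit F E c 3).Adelic) = (w : (quasiSplit F E c 3).Adelic)
        simp only [Subgroup.coe_inv]
        group)
      continuous_toFun := Continuous.subtype_mk ((continuous_const.mul continuous_subtype_val).mul continuous_const) _
      continuous_invFun := Continuous.subtype_mk ((continuous_const.mul continuous_subtype_val).mul continuous_const) _ }
  have himage : (fun v : adelicUnipotent F E c 3 => (⟨(β : (quasiSplit F E c 3).Adelic)⁻¹ * (v : (quasiSplit F E c 3).Adelic) * (β : (quasiSplit F E c 3).Adelic),
        borel_inv_mul_mul_mem_adelicUnipotent β v⟩ : adelicUnipotent F E c 3)) '' heisFundamentalDomain F E c hc =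
      e.toMeasurableEquiv '' heisFundamentalDomain F E c hc := rfl
  rw [himage, MeasurableEquiv.measurableSet_image]
  exact measurableSet_heisFundamentalDomain hc

/-- **`β⁻¹ 𝓕_N β` is a measurable fundamental domain for `N(F)` acting on `N(𝔸_F)` by left translation, for every measure** (`β ∈ B(𝔸_F)` rational).
[cite: Rogawski1990, §2.1] -/
theorem isFundamentalDomain_borelConj_image (hc : c * c = 1) (β : borelAdelic F E c 3)
    (hβ : (β : (quasiSplit F E c 3).Adelic) ∈ (quasiSplit F E c 3).arithmeticSubgroup) (μ : Measure (adelicUnipotent F E c 3)) :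
    IsFundamentalDomain (rationalUnipotent F E c 3)
      ((fun v : adelicUnipotent F E c 3 => (⟨(β : (quasiSplit F E c 3).Adelic)⁻¹ * (v : (quasiSplit F E c 3).Adelic) * (β : (quasiSplit F E c 3).Adelic),
        borel_inv_mul_mul_mem_adelicUnipotent β v⟩ : adelicUnipotent F E c 3)) '' heisFundamentalDomain F E c hc) μ :=
  IsFundamentalDomain.mk' (measurableSet_borelConj_image hc β).nullMeasurableSet (existsUnique_smul_mem_borelConj_image hc β hβ)

end Measure

end UnitaryGroup

end Literature.NumberTheory.Automorphic

end
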